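import Mathlib
import Summits.MatrixMultiplication.MatrixMultiplication.Theorems.SnSubsetDichotomyPolynomialSlackHubFibring
import Summits.MatrixMultiplication.MatrixMultiplication.Theorems.SnSubsetDichotomyPolynomialSlackDepletionBernstein
import Summits.MatrixMultiplication.MatrixMultiplication.Theorems.SnSubsetDichotomyPolynomialSlackBlockCounts
import Summits.MatrixMultiplication.MatrixMultiplication.Theorems.SnSubsetDichotomyPolynomialSlackGoodValueOfSum

/-!
# The depleted flat atom: a hub lemma from partial depletion

Crux `Summit.MatrixMultiplication.MatrixMultiplication.Theses.SnSubsetDichotomy.PolynomialSlack`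
(item `stmt-MatrixMultiplication-8306`), level-one programme, line transport-split-hull, lead c9
(programme B, stub W1, the generalised hub lemma). For a TPP triple `S, T, U ⊆ S_n` of non-empty sets
with quotient profiles `d_A, d_B, d_C`, a hub position `k` of `U` and a FLAT ATOM `I × J`
(`β ≤ d_B(j,k) ≤ 2β` on `J`, `γ ≤ d_C(k,i) ≤ 2γ` on `I`, `β, γ ≥ 16/n`), write `p_B = d_B(·,k) - 1/n`,
`p_C = d_C(k,·) - 1/n`, `W = (Σ_J p_B)(Σ_I p_C)`, `μ(v) = #{u ∈ U : u k = v}/|U|`,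
`X(v) = #{t ∈ T : t⁻¹v ∈ J}/|T|`, `Y(v) = #{s ∈ S : s⁻¹v ∈ I}/|S|`. If the atom carries hub mass
`Σ_v μXY ≥ h > 0` and is DEPLETED by a factor `1 - ε`, `Σ_{I×J} d_A p_B p_C ≤ (1-ε)W/n`, then
`|S||T||U| ≤ 10⁷·(1+log n)²·log²(4·(n!/(|S||T|))/ε)·n·B/(ε⁴h²)` for every bound `B` on the volumes of
TPP triples of `S_{n-1}` (`volume_le_of_depleted_flat_atom`). Proof: (1) AREA — the weight
`w = p_C ⊗ p_B` on `I × J` has `0 ≤ w ≤ 4βγ`, `Σ w = W`, `Σ w² ≤ 4βγW`, and the depletion is the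
hypothesis of `pair_depletion_bernstein` at `t = εW/n`, whence `ε²W ≤ 576·n(1+log n)βγ·L`,
`L = log(4n!/(|S||T|ε))`, while flatness gives `(15/16)²βγ|I||J| ≤ W`; (2) FORCED HITS are `μ`-free,
`Σ_v XY = Σ_{I×J} d_A ≤ (W/n)/((15/16)²βγ) =: Z` (`sum_pairMarginal_block_eq`); (3) a GOOD VALUE `v`
with `μXY(v) ≥ h²/(4Z)` (`exists_good_value_of_sum`); (4) FIBRING (`hub_fibring`):
`|S||T||U|·μXY(v) ≤ |I||J|·B`; the constant is `4·576²·(16/15)⁴ < 10⁷`.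
-/
namespace Summit.MatrixMultiplication.MatrixMultiplication.Theorems.PolynomialSlack

set_option linter.dupNamespace false

open scoped BigOperators
open Literature.Combinatorics.Additive (TripleProductProperty)

/-- Area arithmetic: the conclusion `t²/4 ≤ (32GQ/n + 4mt)·L` of the depletion Bernstein inequality at
`t = εW/n`, with `Q ≤ mW`, `m = 4P`, `ε ≤ 1 ≤ G`, `L ≥ 0`, gives `ε²W ≤ 576·n·G·P·L`. [folklore] -/
private theorem dfa_area_arith {G L W P ε m Q nR : ℝ} (hn : 0 < nR) (hG : 1 ≤ G) (hL : 0 ≤ L)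
    (hW : 0 < W) (hP : 0 < P) (hε1 : ε ≤ 1) (hm : m = 4 * P) (hQ : Q ≤ m * W)
    (hbern : (ε * W / nR) ^ 2 / 4 ≤ (32 * G * Q / nR + 4 * m * (ε * W / nR)) * L) :
    ε ^ 2 * W ≤ 576 * nR * G * P * L := by
  subst hm
  have hw : 0 < W / nR := div_pos hW hn
  have hV : 32 * G * Q / nR + 4 * (4 * P) * (ε * W / nR) ≤ 144 * G * P * (W / nR) := by
    have e1 : 32 * G * Q / nR + 4 * (4 * P) * (ε * W / nR) = (32 * G * Q + 16 * P * W * ε) / nR := by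
      ring
    have e2 : 144 * G * P * (W / nR) = (128 * G * (P * W) + 16 * P * W * G) / nR := by ring
    rw [e1, e2]
    refine div_le_div_of_nonneg_right ?_ hn.le
    have h1 := mul_le_mul_of_nonneg_left hQ (by positivity : (0 : ℝ) ≤ 32 * G)
    have h2 := mul_le_mul_of_nonneg_left (hε1.trans hG) (by positivity : (0 : ℝ) ≤ 16 * P * W)
    linarith
  have key : (ε * W / nR) ^ 2 / 4 ≤ 144 * G * P * (W / nR) * L :=
    hbern.trans (mul_le_mul_of_nonneg_right hV hL)
  have key2 : (ε ^ 2 * W) * (W / nR) ≤ (576 * nR * G * P * L) * (W / nR) := by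
    have e1 : (ε * W / nR) ^ 2 / 4 = (ε ^ 2 * W) * (W / nR) / (4 * nR) := by
      field_simp
    have e2 : 144 * G * P * (W / nR) * L = (576 * nR * G * P * L) * (W / nR) / (4 * nR) := by
      field_simp; ring
    rw [e1, e2] at key
    exact (div_le_div_iff_of_pos_right (by positivity)).1 key
  exact le_of_mul_le_mul_right key2 hw

/-- Final arithmetic: area `ε²W ≤ 576·nGPL` (`P = βγ`), flatness `(15/16)βx ≤ σ`, `(15/16)γy ≤ ρ`,
`W = σρ`, and the fibred good value `N·(h/2)²/Z ≤ yxB` with `Z = (W/n)/((15/16)²P)` give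
`N ≤ 10⁷·G²·L²·n·B/(ε⁴h²)` (`4·576²·(16/15)⁴ < 10⁷`). [folklore] -/
private theorem dfa_final_arith {N W σ ρ x y β γ ε h G L Bc nR : ℝ} (hn : 0 < nR)
    (hβ : 0 < β) (hγ : 0 < γ) (hε : 0 < ε) (hh : 0 < h) (hB : 0 ≤ Bc)
    (hx : 0 ≤ x) (hy : 0 ≤ y) (hW0 : 0 < W) (hσ : 15 / 16 * β * x ≤ σ) (hρ : 15 / 16 * γ * y ≤ ρ)
    (hW : W = σ * ρ) (hA : ε ^ 2 * W ≤ 576 * nR * G * (β * γ) * L)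
    (hfib : N * ((h / 2) ^ 2 / (W / nR / ((15 / 16) ^ 2 * (β * γ)))) ≤ y * x * Bc) :
    N ≤ 10 ^ 7 * G ^ 2 * L ^ 2 * nR * Bc / (ε ^ 4 * h ^ 2) := by
  set P : ℝ := β * γ with hP
  have hP0 : 0 < P := mul_pos hβ hγ
  have hc0 : (0 : ℝ) < (15 / 16) ^ 2 * P := by positivity
  -- flatness: `(15/16)² P x y ≤ W`
  have hxy : (15 / 16) ^ 2 * P * (x * y) ≤ W := by
    have h1 := mul_le_mul hσ hρ (by positivity) ((by positivity : (0 : ℝ) ≤ 15 / 16 * β * x).trans hσ)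
    rw [hW, hP]; linarith
  -- the fibred good value, denominators cleared: `N h² n (15/16)² P ≤ 4 x y B W`
  have hZ0 : 0 < W / nR / ((15 / 16) ^ 2 * P) := by positivity
  have h1 : N * (h / 2) ^ 2 ≤ y * x * Bc * (W / nR / ((15 / 16) ^ 2 * P)) := by
    rw [mul_div_assoc'] at hfib
    exact (div_le_iff₀ hZ0).1 hfib
  have h2 : N * h ^ 2 * nR * ((15 / 16) ^ 2 * P) ≤ 4 * (x * y) * Bc * W := by
    have e : y * x * Bc * (W / nR / ((15 / 16) ^ 2 * P)) =
        4 * (x * y) * Bc * W / (4 * nR * ((15 / 16) ^ 2 * P)) := by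
      field_simp
    rw [e, le_div_iff₀ (by positivity)] at h1
    linarith
  -- times `(15/16)² P`, using flatness: `N h² n ((15/16)² P)² ≤ 4 B W²`
  have h3 : N * h ^ 2 * nR * ((15 / 16) ^ 2 * P) ^ 2 ≤ 4 * Bc * W ^ 2 := by
    have h4 := mul_le_mul_of_nonneg_right h2 hc0.le
    have h5 := mul_le_mul_of_nonneg_left hxy (by positivity : (0 : ℝ) ≤ 4 * Bc * W)
    calc N * h ^ 2 * nR * ((15 / 16) ^ 2 * P) ^ 2
        = N * h ^ 2 * nR * ((15 / 16) ^ 2 * P) * ((15 / 16) ^ 2 * P) := by ring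
      _ ≤ 4 * (x * y) * Bc * W * ((15 / 16) ^ 2 * P) := h4
      _ = 4 * Bc * W * ((15 / 16) ^ 2 * P * (x * y)) := by ring
      _ ≤ 4 * Bc * W * W := h5
      _ = 4 * Bc * W ^ 2 := by ring
  -- the area bound, squared
  have h5 : (ε ^ 2 * W) ^ 2 ≤ (576 * nR * G * P * L) ^ 2 :=
    pow_le_pow_left₀ (by positivity) hA 2
  have h6 : N * h ^ 2 * ε ^ 4 * nR * ((15 / 16) ^ 2 * P) ^ 2 ≤ 4 * Bc * (576 * nR * G * P * L) ^ 2 := by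
    calc N * h ^ 2 * ε ^ 4 * nR * ((15 / 16) ^ 2 * P) ^ 2
        = (N * h ^ 2 * nR * ((15 / 16) ^ 2 * P) ^ 2) * ε ^ 4 := by ring
      _ ≤ 4 * Bc * W ^ 2 * ε ^ 4 := mul_le_mul_of_nonneg_right h3 (by positivity)
      _ = 4 * Bc * (ε ^ 2 * W) ^ 2 := by ring
      _ ≤ 4 * Bc * (576 * nR * G * P * L) ^ 2 := mul_le_mul_of_nonneg_left h5 (by positivity)
  -- cancel `n P²`
  have h7 : N * h ^ 2 * ε ^ 4 * (15 / 16 : ℝ) ^ 4 ≤ 4 * 576 ^ 2 * nR * G ^ 2 * L ^ 2 * Bc := by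
    have hnP : 0 < nR * P ^ 2 := by positivity
    have e1 : N * h ^ 2 * ε ^ 4 * nR * ((15 / 16) ^ 2 * P) ^ 2 =
        (N * h ^ 2 * ε ^ 4 * (15 / 16) ^ 4) * (nR * P ^ 2) := by ring
    have e2 : 4 * Bc * (576 * nR * G * P * L) ^ 2 =
        (4 * 576 ^ 2 * nR * G ^ 2 * L ^ 2 * Bc) * (nR * P ^ 2) := by ring
    rw [e1, e2] at h6
    exact le_of_mul_le_mul_right h6 hnP
  -- the constant
  have h8 : (4 : ℝ) * 576 ^ 2 ≤ 10 ^ 7 * (15 / 16) ^ 4 := by norm_num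
  have hR : 0 ≤ nR * G ^ 2 * L ^ 2 * Bc := by positivity
  rw [le_div_iff₀ (by positivity)]
  have h9 : (N * (ε ^ 4 * h ^ 2)) * (15 / 16 : ℝ) ^ 4 ≤
      (10 ^ 7 * G ^ 2 * L ^ 2 * nR * Bc) * (15 / 16 : ℝ) ^ 4 := by
    calc (N * (ε ^ 4 * h ^ 2)) * (15 / 16 : ℝ) ^ 4 = N * h ^ 2 * ε ^ 4 * (15 / 16) ^ 4 := by ring
      _ ≤ 4 * 576 ^ 2 * nR * G ^ 2 * L ^ 2 * Bc := h7
      _ = 4 * 576 ^ 2 * (nR * G ^ 2 * L ^ 2 * Bc) := by ring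
      _ ≤ 10 ^ 7 * (15 / 16) ^ 4 * (nR * G ^ 2 * L ^ 2 * Bc) := mul_le_mul_of_nonneg_right h8 hR
      _ = (10 ^ 7 * G ^ 2 * L ^ 2 * nR * Bc) * (15 / 16 : ℝ) ^ 4 := by ring
  exact le_of_mul_le_mul_right h9 (by positivity)

/-- Block sums of a product weight extended by zero:
`Σ_{i,j} f(i,j)·(a𝟙_I)(i)·(b𝟙_J)(j) = Σ_{i ∈ I} Σ_{j ∈ J} f(i,j)·a(i)·b(j)`. [folklore] -/
private theorem dfa_sum_blockWeight {n : ℕ} (I J : Finset (Fin n)) (f : Fin n → Fin n → ℝ)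
    (a b : Fin n → ℝ) :
    ∑ i : Fin n, ∑ j : Fin n, f i j * ((if i ∈ I then a i else 0) * (if j ∈ J then b j else 0)) =
      ∑ i ∈ I, ∑ j ∈ J, f i j * (a i * b j) := by
  calc ∑ i : Fin n, ∑ j : Fin n, f i j * ((if i ∈ I then a i else 0) * (if j ∈ J then b j else 0))
      = ∑ i ∈ I, ∑ j : Fin n, f i j * (a i * (if j ∈ J then b j else 0)) := by
        rw [← Finset.sum_subset (Finset.subset_univ I)]
        · exact Finset.sum_congr rfl fun i hi => by rw [if_pos hi]
        · exact fun i _ hi => by rw [if_neg hi]; exact Finset.sum_eq_zero fun j _ => by ring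
    _ = ∑ i ∈ I, ∑ j ∈ J, f i j * (a i * b j) := by
        refine Finset.sum_congr rfl fun i _ => ?_
        rw [← Finset.sum_subset (Finset.subset_univ J)]
        · exact Finset.sum_congr rfl fun j hj => by rw [if_pos hj]
        · exact fun j _ hj => by rw [if_neg hj]; ring

set_option maxHeartbeats 1600000 in
/-- **The depleted flat atom (generalised hub lemma).** For `n ≥ 2`, a bound `B` on the volumes of
TPP triples of `S_{n-1}`, a TPP triple `S, T, U ⊆ S_n` of non-empty sets with quotient profiles
`dA, dB, dC`, a hub position `k`, a flat atom `I × J` (`β ≤ dB j k ≤ 2β` on `J`, `γ ≤ dC k i ≤ 2γ` on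
`I`, `β, γ ≥ 16/n`), `0 < ε ≤ 1`, hub mass `Σ_v μ(v)·X(v)·Y(v) ≥ h > 0` and depletion
`Σ_{I×J} dA·(dB - 1/n)·(dC - 1/n) ≤ (1-ε)·(Σ_J (dB - 1/n))·(Σ_I (dC - 1/n))/n`:
`|S||T||U| ≤ 10⁷·(1 + log n)²·log²(4·(n!/(|S||T|))/ε)·n·B/(ε⁴h²)`. Area from
`pair_depletion_bernstein`, μ-free forced hits from `sum_pairMarginal_block_eq`, a good value from
`exists_good_value_of_sum`, and `hub_fibring`. [folklore] -/
theorem volume_le_of_depleted_flat_atom {n : ℕ} (hn : 2 ≤ n) (B : ℕ)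
    (hB : ∀ S' T' U' : Finset (Equiv.Perm (Fin (n - 1))), TripleProductProperty S' T' U' →
      S'.card * T'.card * U'.card ≤ B)
    {S T U : Finset (Equiv.Perm (Fin n))} (hTPP : TripleProductProperty S T U)
    (hS0 : S.Nonempty) (hT0 : T.Nonempty) (hU0 : U.Nonempty)
    (dA dB dC : Fin n → Fin n → ℝ)
    (hdA : ∀ i j, dA i j = (((S ×ˢ T).filter fun st => st.2 j = st.1 i).card : ℝ) / (S.card * T.card : ℕ))
    (hdB : ∀ j k, dB j k = (((T ×ˢ U).filter fun tu => tu.2 k = tu.1 j).card : ℝ) / (T.card * U.card : ℕ))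
    (hdC : ∀ k i, dC k i = (((U ×ˢ S).filter fun us => us.2 i = us.1 k).card : ℝ) / (U.card * S.card : ℕ))
    (k : Fin n) (J I : Finset (Fin n)) (β γ ε h : ℝ) (hβ : 16 / (n : ℝ) ≤ β) (hγ : 16 / (n : ℝ) ≤ γ)
    (hε : 0 < ε) (hε1 : ε ≤ 1) (hh : 0 < h)
    (hJ : ∀ j ∈ J, β ≤ dB j k ∧ dB j k ≤ 2 * β) (hI : ∀ i ∈ I, γ ≤ dC k i ∧ dC k i ≤ 2 * γ)
    (hhub : h ≤ ∑ v : Fin n, ((U.filter fun u => u k = v).card : ℝ) / U.card *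
      ((((T.filter fun t => t⁻¹ v ∈ J).card : ℝ) / T.card) *
        (((S.filter fun s => s⁻¹ v ∈ I).card : ℝ) / S.card)))
    (hdep : ∑ i ∈ I, ∑ j ∈ J, dA i j * (dB j k - 1 / n) * (dC k i - 1 / n) ≤
      (1 - ε) * ((∑ j ∈ J, (dB j k - 1 / n)) * (∑ i ∈ I, (dC k i - 1 / n))) / n) :
    ((S.card * T.card * U.card : ℕ) : ℝ) ≤ 10 ^ 7 * (1 + Real.log n) ^ 2 *
      (Real.log (4 * ((n.factorial : ℝ) / (S.card * T.card : ℕ)) / ε)) ^ 2 * n * B / (ε ^ 4 * h ^ 2) := by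
  classical
  -- the profiles `dB`, `dC` enter only through the flatness hypotheses `hJ`, `hI`
  have _ := hdB
  have _ := hdC
  /- 0. the atom is non-empty (else the hub mass vanishes) -/
  have hJne : J.Nonempty := by
    rw [Finset.nonempty_iff_ne_empty]; rintro rfl
    exact absurd (hhub.trans_eq (Finset.sum_eq_zero fun v _ => by simp)) (not_le.2 hh)
  have hIne : I.Nonempty := by
    rw [Finset.nonempty_iff_ne_empty]; rintro rfl
    exact absurd (hhub.trans_eq (Finset.sum_eq_zero fun v _ => by simp)) (not_le.2 hh)
  /- 1. scalars -/
  have hn1 : 1 ≤ n := by omega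
  have hnR : (2 : ℝ) ≤ n := by exact_mod_cast hn
  have hn0 : (0 : ℝ) < n := by linarith
  have hβ0 : 0 < β := lt_of_lt_of_le (by positivity) hβ
  have hγ0 : 0 < γ := lt_of_lt_of_le (by positivity) hγ
  have hβγ : 0 < β * γ := mul_pos hβ0 hγ0
  have hinvB : 1 / (n : ℝ) ≤ β / 16 := by
    rw [div_le_div_iff₀ hn0 (by norm_num)]; rw [div_le_iff₀ hn0] at hβ; linarith
  have hinvC : 1 / (n : ℝ) ≤ γ / 16 := by
    rw [div_le_div_iff₀ hn0 (by norm_num)]; rw [div_le_iff₀ hn0] at hγ; linarith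
  have h1n : (0 : ℝ) ≤ 1 / n := by positivity
  set cS : ℝ := (S.card : ℝ) with hcS
  set cT : ℝ := (T.card : ℝ) with hcT
  set cU : ℝ := (U.card : ℝ) with hcU
  have hcS0 : 0 < cS := by rw [hcS]; exact_mod_cast hS0.card_pos
  have hcT0 : 0 < cT := by rw [hcT]; exact_mod_cast hT0.card_pos
  have hcU0 : 0 < cU := by rw [hcU]; exact_mod_cast hU0.card_pos
  have hαe : ((S.card * T.card : ℕ) : ℝ) = cS * cT := by push_cast; rw [hcS, hcT]
  have hNe : ((S.card * T.card * U.card : ℕ) : ℝ) = cS * cT * cU := by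
    push_cast; rw [hcS, hcT, hcU]
  have hUcol : ∑ v : Fin n, ((U.filter fun u => u k = v).card : ℝ) = cU := by
    rw [hcU]; exact sum_marginal_col U k
  have hcUne : cU ≠ 0 := hcU0.ne'
  -- the hub-mass hypothesis, left-associated and over `cS, cT, cU`
  have hhub' : 2 * (h / 2) ≤ ∑ v : Fin n, ((U.filter fun u => u k = v).card : ℝ) / cU *
      (((T.filter fun t => t⁻¹ v ∈ J).card : ℝ) / cT) *
        (((S.filter fun s => s⁻¹ v ∈ I).card : ℝ) / cS) := by
    calc 2 * (h / 2) = h := by ring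
      _ ≤ _ := hhub
      _ = _ := Finset.sum_congr rfl fun v _ => by rw [hcS, hcT, hcU]; ring
  clear_value cS cT cU
  /- 2. flatness of the atom and the masses `σ`, `ρ` -/
  have hdA0 : ∀ i j, 0 ≤ dA i j := fun i j => by rw [hdA]; positivity
  have hJ' : ∀ j ∈ J, 15 / 16 * β ≤ dB j k - 1 / n ∧ dB j k - 1 / n ≤ 2 * β := fun j hj =>
    ⟨by linarith [(hJ j hj).1], by linarith [(hJ j hj).2]⟩
  have hI' : ∀ i ∈ I, 15 / 16 * γ ≤ dC k i - 1 / n ∧ dC k i - 1 / n ≤ 2 * γ := fun i hi =>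
    ⟨by linarith [(hI i hi).1], by linarith [(hI i hi).2]⟩
  have hpB0 : ∀ j ∈ J, 0 ≤ dB j k - 1 / n := fun j hj => le_trans (by positivity) (hJ' j hj).1
  have hpC0 : ∀ i ∈ I, 0 ≤ dC k i - 1 / n := fun i hi => le_trans (by positivity) (hI' i hi).1
  set σ : ℝ := ∑ j ∈ J, (dB j k - 1 / n) with hσ
  set ρ : ℝ := ∑ i ∈ I, (dC k i - 1 / n) with hρ
  have hσlo : 15 / 16 * β * J.card ≤ σ := by
    have h1 := Finset.card_nsmul_le_sum J _ _ fun j hj => (hJ' j hj).1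
    rwa [nsmul_eq_mul, mul_comm] at h1
  have hρlo : 15 / 16 * γ * I.card ≤ ρ := by
    have h1 := Finset.card_nsmul_le_sum I _ _ fun i hi => (hI' i hi).1
    rwa [nsmul_eq_mul, mul_comm] at h1
  have hJc : (1 : ℝ) ≤ J.card := by exact_mod_cast hJne.card_pos
  have hIc : (1 : ℝ) ≤ I.card := by exact_mod_cast hIne.card_pos
  have hσ0 : 0 < σ := by nlinarith [mul_le_mul_of_nonneg_left hJc hβ0.le]
  have hρ0 : 0 < ρ := by nlinarith [mul_le_mul_of_nonneg_left hIc hγ0.le]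
  set W : ℝ := σ * ρ with hW
  have hW0 : 0 < W := mul_pos hσ0 hρ0
  /- 3. AREA: the depletion Bernstein inequality for the weight `w = p_C ⊗ p_B` on `I × J` -/
  set w : Fin n → Fin n → ℝ := fun i j =>
    (if i ∈ I then dC k i - 1 / n else 0) * (if j ∈ J then dB j k - 1 / n else 0) with hw
  set m : ℝ := 4 * (β * γ) with hm
  have hu0 : ∀ i, 0 ≤ (if i ∈ I then dC k i - 1 / (n : ℝ) else 0) := fun i => by
    split_ifs with hi; exacts [hpC0 i hi, le_rfl]
  have hule : ∀ i, (if i ∈ I then dC k i - 1 / (n : ℝ) else 0) ≤ 2 * γ := fun i => by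
    split_ifs with hi; exacts [(hI' i hi).2, by positivity]
  have hv0 : ∀ j, 0 ≤ (if j ∈ J then dB j k - 1 / (n : ℝ) else 0) := fun j => by
    split_ifs with hj; exacts [hpB0 j hj, le_rfl]
  have hvle : ∀ j, (if j ∈ J then dB j k - 1 / (n : ℝ) else 0) ≤ 2 * β := fun j => by
    split_ifs with hj; exacts [(hJ' j hj).2, by positivity]
  have hw0 : ∀ i j, 0 ≤ w i j := fun i j => mul_nonneg (hu0 i) (hv0 j)
  have hwm : ∀ i j, w i j ≤ m := fun i j => by
    calc w i j = (if i ∈ I then dC k i - 1 / (n : ℝ) else 0) *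
          (if j ∈ J then dB j k - 1 / (n : ℝ) else 0) := rfl
      _ ≤ (2 * γ) * (2 * β) := mul_le_mul (hule i) (hvle j) (hv0 j) (by positivity)
      _ = m := by rw [hm]; ring
  have hWsum : ∑ i : Fin n, ∑ j : Fin n, w i j = W := by
    have e := dfa_sum_blockWeight I J (fun _ _ => (1 : ℝ)) (fun i => dC k i - 1 / n)
      (fun j => dB j k - 1 / n)
    simp only [one_mul] at e
    simp only [hw]
    rw [e, hW, mul_comm, hρ, hσ, Finset.sum_mul_sum]
  have hQ : ∑ i : Fin n, ∑ j : Fin n, w i j ^ 2 ≤ m * W := by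
    rw [← hWsum, Finset.mul_sum]
    refine Finset.sum_le_sum fun i _ => ?_
    rw [Finset.mul_sum]
    exact Finset.sum_le_sum fun j _ => by
      rw [sq]; exact mul_le_mul_of_nonneg_right (hwm i j) (hw0 i j)
  have hdepw : ∑ i : Fin n, ∑ j : Fin n, dA i j * w i j ≤
      (∑ i : Fin n, ∑ j : Fin n, w i j) / n - ε * W / n := by
    rw [hWsum]
    simp only [hw]
    rw [dfa_sum_blockWeight I J dA]
    calc ∑ i ∈ I, ∑ j ∈ J, dA i j * ((dC k i - 1 / n) * (dB j k - 1 / n))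
        = ∑ i ∈ I, ∑ j ∈ J, dA i j * (dB j k - 1 / n) * (dC k i - 1 / n) :=
          Finset.sum_congr rfl fun i _ => Finset.sum_congr rfl fun j _ => by ring
      _ ≤ (1 - ε) * W / n := hdep
      _ = W / n - ε * W / n := by ring
  have hinjA := injOn_quot_first hTPP hU0
  have hbern := pair_depletion_bernstein hn1 S T hS0 hT0 hinjA dA hdA w m (ε * W / n) hw0 hwm
    (by positivity) hdepw
  rw [hWsum] at hbern
  have harg : 4 * ((n.factorial : ℝ) / (S.card * T.card : ℕ)) * (W / n) / (ε * W / n) =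
      4 * ((n.factorial : ℝ) / (S.card * T.card : ℕ)) / ε := by
    field_simp
  rw [harg] at hbern
  -- packing: `K = n!/(|S||T|) ≥ 1`, so `L = log(4K/ε) ≥ 0`
  set K : ℝ := (n.factorial : ℝ) / (S.card * T.card : ℕ) with hK
  have hST0 : (0 : ℝ) < ((S.card * T.card : ℕ) : ℝ) := by
    exact_mod_cast Nat.mul_pos hS0.card_pos hT0.card_pos
  have hK1 : 1 ≤ K := by
    rw [hK, le_div_iff₀ hST0, one_mul]
    exact_mod_cast card_mul_card_le_factorial_of_injOn hinjA
  set L : ℝ := Real.log (4 * K / ε) with hL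
  have hL0 : 0 ≤ L := by
    rw [hL]; refine Real.log_nonneg ?_
    rw [le_div_iff₀ hε]; nlinarith
  set G : ℝ := 1 + Real.log n with hG
  have hG1 : 1 ≤ G := by
    rw [hG]; linarith [Real.log_nonneg (show (1 : ℝ) ≤ n by linarith)]
  have harea : ε ^ 2 * W ≤ 576 * n * G * (β * γ) * L :=
    dfa_area_arith hn0 hG1 hL0 hW0 hβγ hε1 hm hQ hbern
  /- 4. the three laws at the hub -/
  set mA : Fin n → Fin n → ℝ :=
    fun i j => (((S ×ˢ T).filter fun st => st.2 j = st.1 i).card : ℝ) with hmA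
  have hdA' : ∀ i j, dA i j = mA i j / (cS * cT) := fun i j => by rw [hdA, hαe]
  clear_value mA
  set μ : Fin n → ℝ := fun v => ((U.filter fun u => u k = v).card : ℝ) / cU with hμ
  set X : Fin n → ℝ := fun v => ((T.filter fun t => t⁻¹ v ∈ J).card : ℝ) / cT with hX
  set Y : Fin n → ℝ := fun v => ((S.filter fun s => s⁻¹ v ∈ I).card : ℝ) / cS with hY
  have hμ0 : ∀ v, 0 ≤ μ v := fun v => by rw [hμ]; exact div_nonneg (Nat.cast_nonneg _) hcU0.le
  have hX0 : ∀ v, 0 ≤ X v := fun v => by rw [hX]; exact div_nonneg (Nat.cast_nonneg _) hcT0.le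
  have hY0 : ∀ v, 0 ≤ Y v := fun v => by rw [hY]; exact div_nonneg (Nat.cast_nonneg _) hcS0.le
  have hμ1 : ∑ v : Fin n, μ v = 1 := by
    rw [hμ]; dsimp only
    rw [← Finset.sum_div, hUcol, div_self hcUne]
  have hsum : 2 * (h / 2) ≤ ∑ v : Fin n, μ v * X v * Y v := by
    have e : ∑ v : Fin n, μ v * X v * Y v = ∑ v : Fin n, ((U.filter fun u => u k = v).card : ℝ) / cU *
        (((T.filter fun t => t⁻¹ v ∈ J).card : ℝ) / cT) *
          (((S.filter fun s => s⁻¹ v ∈ I).card : ℝ) / cS) := by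
      refine Finset.sum_congr rfl fun v _ => ?_
      rw [hμ, hX, hY]
    rw [e]; exact hhub'
  clear_value μ X Y
  have key2T : ∀ a b : ℝ, a / cT * (b / cS) = a * b / (cS * cT) := by
    intro a b; rw [div_mul_div_comm, mul_comm cT cS]
  /- 5. FORCED HITS: `Σ_v X Y = Σ_{I×J} dA ≤ (W/n)/((15/16)²βγ)` -/
  have hc2 : 0 < (15 / 16) ^ 2 * (β * γ) := by positivity
  set Z : ℝ := W / n / ((15 / 16) ^ 2 * (β * γ)) with hZ
  have hZ0 : 0 < Z := by positivity
  have hforced : ∑ v : Fin n, X v * Y v ≤ Z := by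
    have hblock := sum_pairMarginal_block_eq S T I J
    have hblockR : ∑ i ∈ I, ∑ j ∈ J, mA i j = ∑ v : Fin n,
        ((T.filter fun t => t⁻¹ v ∈ J).card : ℝ) * ((S.filter fun s => s⁻¹ v ∈ I).card : ℝ) := by
      simp only [hmA]; exact_mod_cast hblock
    have e1 : ∑ v : Fin n, X v * Y v = ∑ i ∈ I, ∑ j ∈ J, dA i j := by
      have h' : ∑ v : Fin n, X v * Y v = (∑ i ∈ I, ∑ j ∈ J, mA i j) / (cS * cT) := by
        rw [hblockR, Finset.sum_div]
        refine Finset.sum_congr rfl fun v _ => ?_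
        rw [hX, hY]; dsimp only
        rw [key2T]
      rw [h', Finset.sum_div]
      refine Finset.sum_congr rfl fun i _ => ?_
      rw [Finset.sum_div]
      exact Finset.sum_congr rfl fun j _ => (hdA' i j).symm
    have e2 : (15 / 16) ^ 2 * (β * γ) * ∑ i ∈ I, ∑ j ∈ J, dA i j ≤
        ∑ i ∈ I, ∑ j ∈ J, dA i j * (dB j k - 1 / n) * (dC k i - 1 / n) := by
      rw [Finset.mul_sum]
      refine Finset.sum_le_sum fun i hi => ?_
      rw [Finset.mul_sum]
      refine Finset.sum_le_sum fun j hj => ?_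
      have hb := (hJ' j hj).1
      have hc := (hI' i hi).1
      have hA := hdA0 i j
      calc (15 / 16) ^ 2 * (β * γ) * dA i j = dA i j * (15 / 16 * β) * (15 / 16 * γ) := by ring
        _ ≤ dA i j * (dB j k - 1 / n) * (15 / 16 * γ) :=
            mul_le_mul_of_nonneg_right (mul_le_mul_of_nonneg_left hb hA) (by positivity)
        _ ≤ dA i j * (dB j k - 1 / n) * (dC k i - 1 / n) :=
            mul_le_mul_of_nonneg_left hc (mul_nonneg hA (hpB0 j hj))
    rw [e1, hZ, le_div_iff₀ hc2]
    calc (∑ i ∈ I, ∑ j ∈ J, dA i j) * ((15 / 16) ^ 2 * (β * γ))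
        = (15 / 16) ^ 2 * (β * γ) * ∑ i ∈ I, ∑ j ∈ J, dA i j := mul_comm _ _
      _ ≤ _ := e2
      _ ≤ (1 - ε) * W / n := hdep
      _ ≤ W / n := div_le_div_of_nonneg_right (by nlinarith) hn0.le
  /- 6. a good common value -/
  obtain ⟨v, hv⟩ :=
    exists_good_value_of_sum μ X Y (h / 2) Z hμ0 hμ1.le hX0 hY0 (half_pos hh) hZ0 hsum hforced
  /- 7. fibring at `(k, v)` -/
  have hfibR : ((S.filter fun s => s⁻¹ v ∈ I).card : ℝ) * ((T.filter fun t => t⁻¹ v ∈ J).card : ℝ) *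
      ((U.filter fun u => u k = v).card : ℝ) ≤ (I.card : ℝ) * (J.card : ℝ) * B := by
    exact_mod_cast hub_fibring B hB hTPP I J k v
  have key3 : ∀ a b c : ℝ, cS * cT * cU * (a / cU * (b / cT) * (c / cS)) = c * b * a := by
    intro a b c; field_simp
  have hvol : cS * cT * cU * (μ v * X v * Y v) =
      ((S.filter fun s => s⁻¹ v ∈ I).card : ℝ) * ((T.filter fun t => t⁻¹ v ∈ J).card : ℝ) *
        ((U.filter fun u => u k = v).card : ℝ) := by
    rw [hμ, hX, hY]; dsimp only
    rw [key3]
  have hN0 : 0 < cS * cT * cU := mul_pos (mul_pos hcS0 hcT0) hcU0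
  have hmain : cS * cT * cU * ((h / 2) ^ 2 / Z) ≤ (I.card : ℝ) * (J.card : ℝ) * B :=
    calc cS * cT * cU * ((h / 2) ^ 2 / Z) ≤ cS * cT * cU * (μ v * X v * Y v) :=
          mul_le_mul_of_nonneg_left hv hN0.le
      _ = _ := hvol
      _ ≤ _ := hfibR
  /- 8. arithmetic -/
  rw [hNe]
  exact dfa_final_arith hn0 hβ0 hγ0 hε hh (Nat.cast_nonneg B) (Nat.cast_nonneg J.card)
    (Nat.cast_nonneg I.card) hW0 hσlo hρlo hW harea hmain

end Summit.MatrixMultiplication.MatrixMultiplication.Theorems.PolynomialSlack
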